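import Mathlib
import Summits.NavierStokesRegularity.NavierStokesRegularity.Theses.KelvinCirculationBudget
import HarnessLib

/-!
# Route KelvinCirculationBudget — `Assembly` PROVED (stmt-NavierStokesRegularity-18360; pure logic)

`CircBudget → CircToTypeI → NoTypeIBlowup → NavierStokesRegularity` over the proved frame
`typeICertificateLadder_noBlowupToClay_proof` (stmt-0055): exactly the `have hA : Assembly` step of
the route's deciding theorem `closes`, landed as the item's closing declaration.

HONEST FRAMING: pure logic; the route's cruxes `CircBudget`, `CircToTypeI`, `NoTypeIBlowup` remain
OPEN hypotheses; nothing here bears on the regularity question. Lands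
`--workitem stmt-NavierStokesRegularity-18360` (typer seat g19 of cell pub-ns-dss, idle-row item).
-/

namespace Summit.NavierStokesRegularity.NavierStokesRegularity.Theorems

set_option linter.dupNamespace false

/-- **`Assembly` of route KelvinCirculationBudget (stmt-NavierStokesRegularity-18360)**: the three
cruxes give Clay (A) through `typeICertificateLadder_noBlowupToClay_proof`. [this file] -/
theorem kelvinCirculationBudget_assembly_proof : Theses.KelvinCirculationBudget.Assembly := by
  intro k₁ k₂ k₃
  refine typeICertificateLadder_noBlowupToClay_proof ?_
  intro ν T hν hT u p hcl hLH hdec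
  exact k₃ ν T hν hT u p hcl hLH hdec (k₂ ν T hν hT u p hcl hLH hdec (k₁ ν T hν hT u p hcl hLH hdec))

end Summit.NavierStokesRegularity.NavierStokesRegularity.Theorems
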